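import Summits.QuantumFields.YangMills.Theorems.ParabolicTrajectoryContinuumLimitOnTrajectoryDefsC
import Literature.MathematicalPhysics.QuantumFieldTheory.WilsonOddRPNegCoords

/-!
# Route `ParabolicTrajectory`, crux `ContinuumLimitOnTrajectory` (stmt-QuantumFields-10522), line `two-orbit-synchronisation`:
# reflection positivity of slab observables on the scheme's ODD tori (`TorusSlabRP` discharged)

Helper file of the line lead (seat c3, `prover-line-stmt-QuantumFields-10522-c3-0`). Skeleton v3.1–v3.3 named the
site-reflection positivity of slab observables on the scheme's tori `2L_k+1` as an INPUT `TorusSlabRP r sch`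
(`…DefsC` §6) and fed it from crux (B)'s OS-currency gap (`torusSlabRP_of_torusOSGap`, the `m = 0` case), because the two
reflection-positivity theorems then in use need an EVEN torus side. The tree meanwhile carries Osterwalder–Seiler
positivity on the ODD torus in the site-reflection coordinates `t ↦ −t`
(`WilsonOddRPNegCoords.wilsonExpectation_nonneg_of_negCovariant`: torus `2S+1`, `S ≥ 1`, `β ≥ 0`, reflection
`GaugeConfig.negReflect`, observables of the NEGATIVE half `S+1 ≤ t ≤ 2S`). This file transports it to the slab
observables of `TorusSlabRP` (links based at times `1 … w`, `2w ≤ L_k`): with `g := X ∘ negReflect` (a function of the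
negative half, since `negReflect` reads a link based at time `t ∈ [1, w]` through links based at `2S+1−t` or `2S−t`,
both in `[S+1, 2S]`) the covariant theorem gives `0 ≤ ∫ X(Θ'U) conj X(U) dμ`, whose complex conjugate is the OS pairing
`∫ conj X(Θ'U) X(U) dμ` of `TorusSlabRP`. Along a scheme, `β_k ≥ 0` eventually (in the crux: `β_k → ∞`) and `L_k ≥ 1`
eventually (`a_k L_k → ∞`) give `TorusSlabRP r sch` (`torusSlabRP_of_eventually_nonneg`,
`torusSlabRP_of_tendsto`): the approximate-RP stub `stub_arp : ARPOfRP` no longer consumes the IR input `TorusOSGap`.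
Refs: OsterwalderSeiler1978 §2; Seiler1982 Ch. 2; FrohlichIsraelLiebSimon1978 Thm 2.1 (all via the tree theorem).
-/

set_option autoImplicit false

open MeasureTheory Filter Topology
open scoped ComplexConjugate ComplexOrder
open Literature.MathematicalPhysics.QuantumFieldTheory Literature.MathematicalPhysics.QuantumLattice
open Literature.MathematicalPhysics.AQFT Literature.Probability.LatticeModels

noncomputable section

namespace Summit.QuantumFields.YangMills.Cruxes.ContinuumLimitOnTrajectory.TwoOrbitSynchronisation

namespace SlabRP

open WilsonNegRP

variable {G : Type} [Group G]

/-- The two links through which `negReflect` reads a link based at a time `t ∈ [1, w]`, `2w ≤ S`, `1 ≤ S`, are based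
at times in `[S+1, 2S]` (the negative half of the odd torus `2S+1`): spatial links at `2S+1−t`, temporal links at
`2S−t`. Stated as: the value of `U.negReflect` at such a link depends only on the negative-half coordinates of `U`. -/
theorem negReflect_apply_eq_of_agree_negSide {L S : ℕ} [NeZero L] (hL : L = 2 * S + 1) (hS : 1 ≤ S) {w : ℕ}
    (hw : 2 * w ≤ S) {U V : GaugeConfig 4 L G}
    (hUV : ∀ e ∈ (↑(negSideEdges (d := 4) (L := L) S) : Set (Edge 4 L)), U e = V e)
    (e : Edge 4 L) (he : 1 ≤ (e.1 0).val ∧ (e.1 0).val ≤ w) :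
    U.negReflect e = V.negReflect e := by
  haveI : Fact (1 < L) := ⟨by omega⟩
  have hlt := ZMod.val_lt (e.1 0)
  simp only [GaugeConfig.negReflect]
  by_cases h2 : e.2 = 0
  · rw [if_pos h2, if_pos h2]
    congr 1
    refine hUV _ ?_
    simp only [Finset.mem_coe, negSideEdges, Finset.mem_filter, Finset.mem_univ, true_and]
    rw [WilsonSiteRP.val_negReflect_shift_zero]
    rw [if_neg (by omega)]
    omega
  · rw [if_neg h2, if_neg h2]
    refine hUV _ ?_
    simp only [Finset.mem_coe, negSideEdges, Finset.mem_filter, Finset.mem_univ, true_and]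
    rw [WilsonSiteRP.val_negReflect]
    rw [if_neg (by omega)]
    omega

/-- A slab observable read through `negReflect` is a function of the negative-half coordinates. -/
theorem comp_negReflect_eq_of_agree_negSide {L S : ℕ} [NeZero L] (hL : L = 2 * S + 1) (hS : 1 ≤ S) {w : ℕ}
    (hw : 2 * w ≤ S) {X : GaugeConfig 4 L G → ℂ}
    (hXd : DependsOn X {e : Edge 4 L | 1 ≤ (e.1 0).val ∧ (e.1 0).val ≤ w}) {U V : GaugeConfig 4 L G}
    (hUV : ∀ e ∈ (↑(negSideEdges (d := 4) (L := L) S) : Set (Edge 4 L)), U e = V e) :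
    X U.negReflect = X V.negReflect :=
  hXd fun e he => negReflect_apply_eq_of_agree_negSide hL hS hw hUV e he

/-- A slab observable does not see the layer links `S → S+1` (`w < S`): `X (translateLayer S Y U) = X U`. -/
theorem apply_translateLayer {L S : ℕ} [NeZero L] (hS : 1 ≤ S) {w : ℕ} (hw : 2 * w ≤ S)
    {X : GaugeConfig 4 L G → ℂ} (hXd : DependsOn X {e : Edge 4 L | 1 ≤ (e.1 0).val ∧ (e.1 0).val ≤ w})
    (Y U : GaugeConfig 4 L G) : X (translateLayer S Y U) = X U := by
  refine hXd fun e he => ?_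
  simp only [Set.mem_setOf_eq] at he
  simp only [translateLayer]
  rw [if_neg, mul_one]
  rintro ⟨-, h⟩
  omega

variable [TopologicalSpace G] [IsTopologicalGroup G] [CompactSpace G] [MeasurableSpace G] [BorelSpace G]

/-- **Site-reflection positivity of slab observables on one odd torus.** On the torus `(ℤ/Lℤ)⁴`, `L = 2S+1`, `S ≥ 1`,
for continuous `ρ`, `β ≥ 0` and a bounded measurable `X` depending only on the links based at times `1 … w` with
`2w ≤ S`, the OS pairing `∫ conj X(Θ'U) · X(U) dμ_{Λ,β}` (`Θ' = negReflect`) is real and non-negative. -/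
theorem integral_conj_negReflect_mul_nonneg {L S N : ℕ} [NeZero L] (hL : L = 2 * S + 1) (hS : 1 ≤ S)
    (ρ : G →* Matrix (Fin N) (Fin N) ℂ) (hρ : Continuous ρ) {β : ℝ} (hβ : 0 ≤ β) {w : ℕ} (hw : 2 * w ≤ S)
    (X : GaugeConfig 4 L G → ℂ) (hXm : Measurable X) (hXb : ∃ B, ∀ U, ‖X U‖ ≤ B)
    (hXd : DependsOn X {e : Edge 4 L | 1 ≤ (e.1 0).val ∧ (e.1 0).val ≤ w}) :
    0 ≤ ∫ U, conj (X U.negReflect) * X U ∂(wilsonMeasure ρ β) := by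
  obtain ⟨B, hB⟩ := hXb
  have hnm : Measurable (GaugeConfig.negReflect : GaugeConfig 4 L G → GaugeConfig 4 L G) :=
    WilsonSiteRP.measurable_negReflect
  -- the covariant odd-torus theorem with `K = Unit`, `g = X ∘ negReflect`, `Φ U = X(Θ'U) · conj X(U)`
  set g : GaugeConfig 4 L G → ℂ := fun U => X U.negReflect with hg
  set Φ : GaugeConfig 4 L G → ℂ := fun U => X U.negReflect * conj (X U) with hΦ
  have hgm : Measurable g := hXm.comp hnm
  have hΦm : Measurable Φ := hgm.mul (Complex.continuous_conj.measurable.comp hXm)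
  have hgdep : DependsOn g (↑(negSideEdges S ∪ layerEdges S ∪ sliceZeroEdges : Finset (Edge 4 L)) :
      Set (Edge 4 L)) := by
    intro U V hUV
    exact comp_negReflect_eq_of_agree_negSide hL hS hw hXd fun e he => hUV e (by
      rw [Finset.coe_union, Finset.coe_union]
      exact Or.inl (Or.inl he))
  have hpos : 0 ≤ wilsonExpectation ρ β Φ := by
    refine wilsonExpectation_nonneg_of_negCovariant ρ hL hS hρ hβ (K := Unit) (g := fun _ => g)
      (fun _ => hgm) (Kg := B) (fun _ U => hB _) (fun _ => hgdep) hΦm fun U Y => ?_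
    rw [Fintype.sum_unique]
    simp only [hg, hΦ, WilsonSiteRP.negReflect_negReflect_config]
    congr 1
    · -- `X (Θ'(translateLayer S Y U)) = X (Θ'(splice layer (U, Y)))`: both read `U` on the negative half
      have h1 : X (translateLayer S Y U).negReflect = X U.negReflect :=
        comp_negReflect_eq_of_agree_negSide hL hS hw hXd fun e he => by
          simp only [Finset.mem_coe, negSideEdges, Finset.mem_filter, Finset.mem_univ, true_and] at he
          simp only [translateLayer]
          rw [if_neg, mul_one]
          rintro ⟨-, h⟩
          omega
      have h2 : X (GaugeConfig.negReflect (LatticeRP.splice (layerEdges S) (U, Y))) = X U.negReflect :=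
        comp_negReflect_eq_of_agree_negSide hL hS hw hXd (U := LatticeRP.splice (layerEdges S) (U, Y))
          fun e he => by
          simp only [Finset.mem_coe, negSideEdges, Finset.mem_filter, Finset.mem_univ, true_and] at he
          rw [LatticeRP.splice_apply, if_neg]
          simp only [layerEdges, Finset.mem_filter, Finset.mem_univ, true_and, not_and]
          intro _ h
          omega
      rw [h1, h2]
    · rw [apply_translateLayer hS hw hXd]
  -- conjugate
  have hconj : (∫ U, conj (X U.negReflect) * X U ∂(wilsonMeasure ρ β)) = conj (wilsonExpectation ρ β Φ) := by
    unfold wilsonExpectation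
    rw [← integral_conj]
    refine integral_congr_ae (ae_of_all _ fun U => ?_)
    simp only [hΦ, map_mul, Complex.conj_conj]
  rw [hconj]
  exact star_nonneg_iff.2 hpos

end SlabRP

/-- Along any scheme the torus half-side is eventually positive (`a_k L_k → ∞`). -/
theorem eventually_one_le_L {ι : Type} (sch : SpeciesScheme ι) : ∀ᶠ k in atTop, 1 ≤ sch.L k := by
  filter_upwards [sch.tendsto_L.eventually_ge_atTop 1] with k hk
  by_contra h
  have h0 : sch.L k = 0 := by omega
  rw [h0, Nat.cast_zero, mul_zero] at hk
  exact absurd hk (by norm_num)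

/-- **`TorusSlabRP` discharged**: if the couplings of the scheme are eventually non-negative, the OS pairing of every
slab observable on the scheme's odd tori `2L_k+1` for the site reflection `t ↦ −t` is eventually (in `k`) real and
non-negative. -/
theorem torusSlabRP_of_eventually_nonneg :
    ∀ {G : Type} [Group G] [TopologicalSpace G] [IsTopologicalGroup G] [CompactSpace G]
      [MeasurableSpace G] [BorelSpace G] (r : LatticeRep G) (sch : SpeciesScheme (YMSpecies G)),
      (∀ᶠ k in atTop, 0 ≤ sch.β k) → TorusSlabRP r sch := by
  intro G _ _ _ _ _ _ r sch hβ
  obtain ⟨k₀, hk₀⟩ := eventually_atTop.1 (hβ.and (eventually_one_le_L sch))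
  refine ⟨k₀, fun k hk w X hXm hXb hXd hw => ?_⟩
  obtain ⟨hβk, hLk⟩ := hk₀ k hk
  have h := SlabRP.integral_conj_negReflect_mul_nonneg (L := sch.side k) (S := sch.L k) rfl hLk r.ρ r.continuous
    hβk hw X hXm hXb hXd
  exact ⟨(Complex.nonneg_iff.1 h).1, (Complex.nonneg_iff.1 h).2.symm⟩

/-- **`TorusSlabRP` along a weak-coupling scheme** (`β_k → ∞`, the crux's asymptotic-freedom clause). -/
theorem torusSlabRP_of_tendsto :
    ∀ {G : Type} [Group G] [TopologicalSpace G] [IsTopologicalGroup G] [CompactSpace G]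
      [MeasurableSpace G] [BorelSpace G] (r : LatticeRep G) (sch : SpeciesScheme (YMSpecies G)),
      Tendsto sch.β atTop atTop → TorusSlabRP r sch :=
  fun r sch hβ => torusSlabRP_of_eventually_nonneg r sch (hβ.eventually_ge_atTop 0)

end Summit.QuantumFields.YangMills.Cruxes.ContinuumLimitOnTrajectory.TwoOrbitSynchronisation

end
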